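import Literature.AnabelianGeometry.SemiGraphs.TemperedAbsolutenessLeafGalSectJunction
import Literature.AnabelianGeometry.SemiGraphs.TemperedAbsolutenessLeafReductionNonVacuity
import Literature.AnabelianGeometry.AbsoluteAnabelian.GaloisSectionsFactsThm13iiSchema
import HarnessLib

/-!
# [SemiAnbd] Cor. 6.10 / 6.11 (F-1656 / F-1655): the hypothesis bundle of the `…_of_galSect` closers —
# INCLUDING the tempered ↔ profinite DICTIONARY at which F-0103 `GalSect.Thm_1_3_ii_cusps` holds — is JOINTLY
# SATISFIABLE at the cusped punctured-disc certificate, and the closers FIRE there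

Mochizuki, *Semi-graphs of anabelioids*, Publ. RIMS **42** (2006) [SemiAnbd], Cor. 6.10 / Cor. 6.11 p. 77,
over [Mzk8] = *Galois sections in absolute anabelian geometry*, Nagoya Math. J. **179** (2005), Thm. 1.3 (ii)
p. 6. [cite: MochizukiSemiAnbd2006, Cor 6.10 p.77] [cite: MochizukiGalSect2005, Thm 1.3 (ii) p.6]

PROOF-ONLY companion (abc-iut cell, D-0079 L-F pack D, seat abc-iut-f-168 gen 6; no `def`, no `instance`, no
new named fact) of `TemperedAbsolutenessLeafGalSectJunction.lean` (this seat, same day: the closers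
`AbsolutenessOrigin.temperedAbsolutenessHolds_of_galSect` / `genusZeroTempAbsolutenessHolds_of_galSect`, whose
[Mzk8] Thm. 1.3 leaves are consumed BY NAME from the FACT-LIST row F-0103 and the L4 cuspidal-data interface
through ONE dictionary hypothesis `hgs`).  A conditional closer with an unsatisfiable antecedent would be
worthless; this file shows:

* `TemperedCurve.exists_galSect_dictionary_of_disc` — at every §6 datum of PUNCTURED-DISC TYPE (`aug` onto
  `G_{ℚ_p}`, `ι : Π^temp → Π̂` bijective, one closed point, `D_x = Π^temp`, `I_x = Z(Π^temp)`) the dictionary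
  EXISTS with the FACT HOLDING: `E :=` the INTENDED extension `1 → Δ → Π̂ → G_{ℚ_p} → 1` of the datum
  itself (`E.arith := Π̂`, `E.gal := G_{ℚ_p}`, `E.aug := augHat`), `j := id`, `C :=` its one cusp, `D := ⊤`,
  `I := ⊤ ∩ Δ`; then F-0103 `GalSect.Thm_1_3_ii_cusps C` is a THEOREM there — clause (1) `C_{Π̂}(Π̂) = Π̂`
  (`isCommensurablyTerminal_top`), clause (2) every `H ≤ Δ = Ker(augHat) = ι(Z(Π^temp))` is central, hence
  normal, hence `C_{Π̂}(H) = Π̂ = D`;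
* `AbsolutenessOrigin.exists_cusped_certificate_galSect_leaves` — the gen-5 certificate
  (`exists_cusped_certificate_leaves`, p453174: `Π^temp = G_{ℚ_p} × Ẑ`, one `K`-rational cusp, canonical
  structures := all splittings, Kummer datum `H¹ = ℤ` with unit image `2ℤ`) ALSO satisfies `hgs`, JOINTLY with
  `h66` (F-1707), `h65` (F-1704), `hDc`, `hgood`, `hsub`, `hstab`, `hCor411` — stated verbatim in the binder
  shapes of the closers (the certificate is rebuilt here because p453174 exports it only existentially);
* `AbsolutenessOrigin.exists_cusped_certificate_temperedAbsoluteness_of_galSect` — END-TO-END: fed term for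
  term into the two closers, the witness yields an `Ω` certifying a curve with a rational cusp at which
  `TemperedAbsolutenessHolds Ω ∧ GenusZeroTempAbsolutenessHolds Ω` — the antecedent IS the closers' and the
  origin is not vacuous.

HONEST LIMITS as in the gen-2/gen-5 files: a toy (abelian `Δ^temp`, abstract Kummer records, one point);
binder-satisfiability evidence, not a model of a hyperbolic curve and not an endorsement; the `∀Ω` closures of
F-1655 / F-1656 remain refuted (p431240); nothing printed is asserted; no side taken on [IUTchIII] Cor. 3.12.
-/

noncomputable section

namespace Literature.AnabelianGeometry.SemiGraphs

open scoped Pointwise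
open _root_.Topology
open Literature.AnabelianGeometry.AbsoluteAnabelian

/-- Every additive automorphism of `ℤ` (namely `± id`) carries every subgroup onto itself (local copy of the
gen-2/gen-5 files' private lemma). [folklore] -/
private theorem addSubgroup_map_int_addEquiv_gs (ψ : ℤ ≃+ ℤ) (U : AddSubgroup ℤ) :
    U.map ψ.toAddMonoidHom = U := by
  have hx : ∀ x : ℤ, ψ x = x * ψ 1 := fun x => by
    conv_lhs => rw [← mul_one x, ← smul_eq_mul]
    rw [map_zsmul, smul_eq_mul]
  have hu : ψ 1 = 1 ∨ ψ 1 = -1 := by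
    refine Int.eq_one_or_neg_one_of_mul_eq_one (v := ψ.symm 1) ?_
    have h := ψ.apply_symm_apply 1
    rw [hx] at h
    rwa [mul_comm] at h
  ext y
  simp only [AddSubgroup.mem_map, AddEquiv.coe_toAddMonoidHom]
  constructor
  · rintro ⟨x, hxU, rfl⟩
    rw [hx]
    rcases hu with h | h
    · rw [h, mul_one]; exact hxU
    · rw [h, mul_neg_one]; exact U.neg_mem hxU
  · intro hy
    rcases hu with h | h
    · exact ⟨y, hy, by rw [hx, h, mul_one]⟩
    · exact ⟨-y, U.neg_mem hy, by rw [hx, h, mul_neg_one, neg_neg]⟩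

variable {p : ℕ} [Fact p.Prime]

namespace TemperedCurve

/-- At a datum of punctured-disc type the kernel of the profinite augmentation `Π̂ → G_{ℚ_p}` is CENTRAL in
`Π̂`: it is `ι(Ker aug) = ι(I_x) = ι(Z(Π^temp))` and `ι` is an isomorphism of abstract groups.
[cite: MochizukiSemiAnbd2006, §6 p.71] -/
theorem ker_augHat_le_center_of_disc (X : TemperedCurve p) (x₀ : X.Pt) (hbij : Function.Bijective X.toHat)
    (hD : ∀ x, X.decomp x = ⊤) (hI : ∀ x, X.inertia x = Subgroup.center X.PiTemp) :
    X.augHat.toMonoidHom.ker ≤ Subgroup.center X.PiHat := by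
  intro y hy
  obtain ⟨z, rfl⟩ := hbij.2 y
  have hz : z ∈ X.inertia x₀ := by
    refine Subgroup.mem_inf.mpr ⟨by rw [hD x₀]; exact Subgroup.mem_top _, ?_⟩
    change X.aug z = 1
    rw [← X.augHat_comp z]
    exact hy
  rw [hI x₀, Subgroup.mem_center_iff] at hz
  rw [Subgroup.mem_center_iff]
  intro w
  obtain ⟨v, rfl⟩ := hbij.2 w
  rw [← map_mul, ← map_mul, hz v]

/-- **The tempered ↔ profinite dictionary of `temperedAbsolutenessHolds_of_galSect` EXISTS, with F-0103
HOLDING, at every datum of punctured-disc type** (`aug` onto `G_{ℚ_p}`, `ι` bijective, one closed point,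
`D_x = Π^temp`, `I_x = Z(Π^temp)`): `E :=` the intended extension `Π̂ ↠ G_{ℚ_p}` of the datum, `j := id`,
`C :=` the one cusp with `D := ⊤`, `I := ⊤ ∩ Ker(augHat)`; `GalSect.Thm_1_3_ii_cusps C` holds because `⊤` is
commensurably terminal and every subgroup of the central `Ker(augHat)` is normal.  Toy; satisfiability
evidence only. [cite: MochizukiGalSect2005, Thm 1.3 (ii) p.6] -/
theorem exists_galSect_dictionary_of_disc (X : TemperedCurve p) [Subsingleton X.Pt] (x₀ : X.Pt)
    (haug : Function.Surjective X.aug) (hbij : Function.Bijective X.toHat) (hD : ∀ x, X.decomp x = ⊤)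
    (hI : ∀ x, X.inertia x = Subgroup.center X.PiTemp) :
    ∃ (E : FundamentalExtension.{0}) (j : X.PiHat →ₜ* E.arith) (C : E.CuspidalData)
      (κ : ∀ x : X.Pt, X.IsCusp x → C.Cusp),
      Function.Injective j ∧
        (∀ (x x' : X.Pt) (hx : X.IsCusp x) (hx' : X.IsCusp x'), κ x hx = κ x' hx' → x = x') ∧
        (∀ (x : X.Pt) (hx : X.IsCusp x),
          C.Dcusp (κ x hx) = ((X.decomp x).map X.toHat.toMonoidHom).map j.toMonoidHom) ∧
        GalSect.Thm_1_3_ii_cusps C := by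
  classical
  haveI : IsGalois ℚ_[p] (AlgebraicClosure ℚ_[p]) := {}
  haveI : CompactSpace (GQp p) := inferInstance
  haveI : TotallyDisconnectedSpace (GQp p) := inferInstance
  haveI : CompactSpace X.PiHat := X.isProfiniteCompletion_toHat.compactSpace
  haveI : TotallyDisconnectedSpace X.PiHat := X.isProfiniteCompletion_toHat.totallyDisconnectedSpace
  -- the INTENDED extension `Π̂ ↠ G_{ℚ_p}` of the datum (`K = ℚ_p`, so `aug`, hence `augHat`, is onto)
  let E : FundamentalExtension.{0} :=
    { arith := ProfiniteGrp.of X.PiHat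
      gal := ProfiniteGrp.of (GQp p)
      aug := X.augHat
      aug_surjective := fun g => by
        obtain ⟨z, hz⟩ := haug g
        exact ⟨X.toHat z, by rw [X.augHat_comp, hz]⟩ }
  let j : X.PiHat →ₜ* E.arith := ContinuousMonoidHom.id X.PiHat
  let C : E.CuspidalData :=
    { Cusp := X.Pt
      finite := Finite.of_subsingleton
      Dcusp := fun _ => ⊤
      Icusp := fun _ => ⊤ ⊓ E.geom
      Icusp_eq := fun _ => rfl
      isClosed_Dcusp := fun _ => by
        rw [Subgroup.coe_top]
        exact isClosed_univ
      eq_of_conj := fun x y _ _ => Subsingleton.elim x y }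
  have hjmap : ∀ K : Subgroup X.PiHat, K.map j.toMonoidHom = K := fun K => by
    ext y
    constructor
    · rintro ⟨z, hz, rfl⟩
      exact hz
    · intro hy
      exact ⟨y, hy, rfl⟩
  have hZ := X.ker_augHat_le_center_of_disc x₀ hbij hD hI
  refine ⟨E, j, C, fun x _ => x, fun _ _ h => h, fun x x' _ _ h => h, fun x _ => ?_, ?_, ?_⟩
  · -- `⊤ = j(ι(D_x))`: `D_x = ⊤`, `ι` onto, `j = id`
    change (⊤ : Subgroup X.PiHat) = ((X.decomp x).map X.toHat.toMonoidHom).map j.toMonoidHom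
    rw [hjmap, hD x, ← MonoidHom.range_eq_map, MonoidHom.range_eq_top.mpr hbij.2]
  · -- clause (1): `C_{Π̂}(⊤) = ⊤`
    intro x
    exact isCommensurablyTerminal_top
  · -- clause (2): every `H ≤ Δ = Ker(augHat) ⊆ Z(Π̂)` is normal, so `C_{Π̂}(H) = ⊤ = D`
    intro x H hH _ _
    change Subgroup.Commensurable.commensurator H = ⊤
    have hHZ : H ≤ Subgroup.center X.PiHat := fun y hy =>
      hZ ((FundamentalExtension.mem_geom E).mp (Subgroup.mem_inf.mp (hH hy)).2)
    refine top_unique fun g _ => ?_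
    rw [Subgroup.Commensurable.commensurator_mem_iff]
    have hN : H.Normal := ⟨fun n hn g => by
      rw [Subgroup.mem_center_iff.mp (hHZ hn) g, mul_inv_cancel_right]
      exact hn⟩
    have hg : g ∈ Subgroup.normalizer (H : Set E.arith) := by
      rw [Subgroup.normalizer_eq_top_iff.mpr hN]
      exact Subgroup.mem_top g
    rw [Subgroup.conjAct_pointwise_smul_eq_self hg]

end TemperedCurve

namespace AbsolutenessOrigin

/-- **NON-VACUITY OF THE HYPOTHESIS BUNDLE OF THE `…_of_galSect` CLOSERS AT A CUSPED CERTIFICATE.**  There are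
an `AbsolutenessOrigin` certificate `Ω`, a §6 datum `X` (punctured-disc type) with a `K`-RATIONAL CUSP,
canonical structures `S` (all splittings), a Kummer datum `k` (`H¹ := ℤ`, unit image `2ℤ ≠ ⊤`) and flags `a`,
ALL CERTIFIED by `Ω` (which certifies every transport record), at which ALL the hypotheses `h66`, `h65`,
`hgs` (the DICTIONARY, with F-0103 holding at it), `hDc`, `hgood`, `hsub`, `hstab`, `hCor411` of
`temperedAbsolutenessHolds_of_galSect` / `genusZeroTempAbsolutenessHolds_of_galSect` hold — stated verbatim in
those binder shapes.  The certificate is the gen-5 one (`exists_cusped_certificate_leaves`), rebuilt.  Toy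
datum; binder-satisfiability evidence only. [cite: MochizukiSemiAnbd2006, Cor 6.10 p.77] -/
theorem exists_cusped_certificate_galSect_leaves (p : ℕ) [Fact p.Prime] :
    ∃ (Ω : AbsolutenessOrigin p) (X : TemperedCurve p) (S : CuspidalStructures X) (k : KummerUnitData X)
      (a : TemperedCurve.CurveArithmeticFlags X),
      Ω.IsHyperbolicCurveOrigin X ∧ Ω.IsStructuresOrigin S ∧ Ω.IsKummerOrigin k ∧ Ω.IsFlagsOrigin a ∧
      (∃ x : X.Pt, X.IsCusp x ∧ X.IsRationalPt x) ∧ S.HasStableReduction ∧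
      (∀ x, (S.canonicalIntegral x).Nonempty) ∧ k.unitImage ≠ ⊤ ∧
      (∀ (Y : TemperedCurve p) (kY : KummerUnitData Y) (t : KummerTransport k kY),
        Ω.IsKummerTransportOrigin t) ∧
      -- h66, h65
      Ω.toTemperedOrigin.ProfiniteOuterIsoLiftsHolds ∧ Ω.toTemperedOrigin.CuspidalAbsolutenessHolds ∧
      -- hgs (the dictionary: an L4 cuspidal datum identified with the cusps of `Π̂`, F-0103 holding there)
      (∀ Y : TemperedCurve p, Ω.IsHyperbolicCurveOrigin Y →
        ∃ (E : FundamentalExtension.{0}) (j : Y.PiHat →ₜ* E.arith) (C : E.CuspidalData)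
          (κ : ∀ x : Y.Pt, Y.IsCusp x → C.Cusp),
          Function.Injective j ∧
            (∀ (x x' : Y.Pt) (hx : Y.IsCusp x) (hx' : Y.IsCusp x'), κ x hx = κ x' hx' → x = x') ∧
            (∀ (x : Y.Pt) (hx : Y.IsCusp x),
              C.Dcusp (κ x hx) = ((Y.decomp x).map Y.toHat.toMonoidHom).map j.toMonoidHom) ∧
            GalSect.Thm_1_3_ii_cusps C) ∧
      -- hDc (G-L5t11g4-1)
      (∀ Y : TemperedCurve p, Ω.IsHyperbolicCurveOrigin Y → ∀ y : Y.Pt,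
        IsCompact (Y.decomp y : Set Y.PiTemp)) ∧
      -- hgood (G-f168-1)
      (∀ (X : TemperedCurve p) (kX : KummerUnitData X), Ω.IsHyperbolicCurveOrigin X →
        Ω.IsKummerOrigin kX → ∀ (Y : TemperedCurve p) (kY : KummerUnitData Y) (t : KummerTransport kX kY),
        Ω.IsHyperbolicCurveOrigin Y → Ω.IsKummerOrigin kY → Ω.IsKummerTransportOrigin t →
        ∀ (αhat : X.PiHat ≃ₜ* Y.PiHat) (β : X.PiTemp ≃ₜ* Y.PiTemp), TemperedCurve.LiesUnder X Y αhat β →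
          (kX.unitImage).map (t.h1OfHat αhat).toAddMonoidHom =
            (kX.unitImage).map (t.h1OfTemp β).toAddMonoidHom) ∧
      -- hsub (G-f168-2)
      (∀ (Y : TemperedCurve p) (SY : CuspidalStructures Y), Ω.IsHyperbolicCurveOrigin Y →
        Ω.IsStructuresOrigin SY → ∀ y : Y.Pt, Y.IsCusp y → ∀ T ∈ SY.canonicalDiscrete y,
          IsClosed (T : Set Y.PiTemp) ∧ T ≤ Y.decomp y) ∧
      -- hstab (G-f168-3)
      (∀ (Y : TemperedCurve p) (SY : CuspidalStructures Y), Ω.IsHyperbolicCurveOrigin Y →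
        Ω.IsStructuresOrigin SY → ∀ y : Y.Pt, Y.IsCusp y → ∀ t ∈ Y.decomp y,
          (∀ T ∈ SY.canonicalDiscrete y, ConjAct.toConjAct t • T ∈ SY.canonicalDiscrete y) ∧
            ∀ T ∈ SY.canonicalIntegral y, ConjAct.toConjAct t • T ∈ SY.canonicalIntegral y) ∧
      -- hCor411 ([Mzk8] Cor. 4.11, absolute form, G-f168-4; Cor. 6.11 only)
      (∀ (X : TemperedCurve p) (SX : CuspidalStructures X) (kX : KummerUnitData X)
        (aX : TemperedCurve.CurveArithmeticFlags X), Ω.IsHyperbolicCurveOrigin X →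
        Ω.IsStructuresOrigin SX → Ω.IsKummerOrigin kX → Ω.IsFlagsOrigin aX →
        SX.HasStableReduction → aX.IsIsogenousToGenusZero →
          Ω.IsUnitwiseAbsolute kX ∧
            ∀ x : X.Pt, X.IsCusp x → X.IsRationalPt x → Ω.IsIntegrallyAbsoluteCusp SX x) := by
  obtain ⟨X, -, haug, hcpt, hbij, ⟨x₀⟩, hsubs, hcusp, hrat, hD, hI, -, hspl⟩ :=
    TemperedCurve.exists_puncturedDisc p
  haveI := hcpt
  haveI := hsubs
  haveI : T2Space X.PiHat := X.isProfiniteCompletion_toHat.t2Space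
  obtain ⟨e, he⟩ := X.exists_continuousMulEquiv_eq_toHat
  let U : AddSubgroup ℤ := AddSubgroup.zmultiples (2 : ℤ)
  let Ω : AbsolutenessOrigin p :=
    { IsHyperbolicCurveOrigin := fun Y => Y = X
      IsDomHomOrigin := fun _ => False
      IsDLocOrigin := fun _ => False
      IsFlagsOrigin := fun _ => True
      IsStructuresOrigin := fun {Y} SY =>
        ∀ y, SY.canonicalDiscrete y = {T | Y.IsSplittingSubgroup y T} ∧
          SY.canonicalIntegral y = {T | Y.IsSplittingSubgroup y T}
      IsKummerOrigin := fun {Y} kY => ∃ φ : kY.H1 ≃+ ℤ, kY.unitImage.map φ.toAddMonoidHom = U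
      IsKummerTransportOrigin := fun _ => True
      IsCyclotomeOrigin := fun _ => False }
  let S : CuspidalStructures X :=
    { HasStableReduction := True
      canonicalIntegral := fun x => {T | X.IsSplittingSubgroup x T}
      canonicalDiscrete := fun x => {T | X.IsSplittingSubgroup x T}
      canonicalIntegral_subset := fun _ => subset_rfl
      isSplitting_of_mem := fun _ _ _ _ hT => hT
      canonicalDiscrete_nonempty := fun x _ _ => hspl x
      canonicalIntegral_nonempty := fun _ x _ _ => hspl x }
  let k : KummerUnitData X := { H1 := ℤ, unitImage := U }
  let a : TemperedCurve.CurveArithmeticFlags X :=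
    { IsOncePuncturedElliptic := False
      IsTorsionPt := fun _ => False
      IsIsogenousToGenusZero := True
      IsAlgebraicPt := fun _ => False
      IsDefinedOverNumberField := False }
  have hU : U ≠ ⊤ := by
    intro h
    have h1 : (1 : ℤ) ∈ U := h ▸ AddSubgroup.mem_top _
    obtain ⟨n, hn⟩ := AddSubgroup.mem_zmultiples_iff.1 h1
    rw [zsmul_eq_mul] at hn
    omega
  -- RIGIDITY: any transport between certified Kummer data carries the unit image onto the unit image
  have hrigidK : ∀ {Y Y' : TemperedCurve p} (kY : KummerUnitData Y) (kY' : KummerUnitData Y'),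
      Ω.IsKummerOrigin kY → Ω.IsKummerOrigin kY' → ∀ f : kY.H1 ≃+ kY'.H1,
        kY.unitImage.map f.toAddMonoidHom = kY'.unitImage := by
    rintro Y Y' kY kY' ⟨φ, hφ⟩ ⟨φ', hφ'⟩ f
    have hback : ∀ {Z : TemperedCurve p} (kZ : KummerUnitData Z) (χ : kZ.H1 ≃+ ℤ),
        kZ.unitImage.map χ.toAddMonoidHom = U → kZ.unitImage = U.map χ.symm.toAddMonoidHom := by
      intro Z kZ χ hχ
      rw [← hχ, AddSubgroup.map_map]
      have hc : χ.symm.toAddMonoidHom.comp χ.toAddMonoidHom = AddMonoidHom.id _ :=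
        AddMonoidHom.ext fun x => χ.symm_apply_apply x
      rw [hc, AddSubgroup.map_id]
    have hcomp : f.toAddMonoidHom.comp φ.symm.toAddMonoidHom =
        φ'.symm.toAddMonoidHom.comp (φ.symm.trans (f.trans φ')).toAddMonoidHom := by
      ext
      simp
    rw [hback kY φ hφ, hback kY' φ' hφ', AddSubgroup.map_map, hcomp, ← AddSubgroup.map_map,
      addSubgroup_map_int_addEquiv_gs (φ.symm.trans (f.trans φ')) U]
  -- the all-splittings structure = centre-splittings of `Π^temp`; `hatOf` of it = centre-splittings of `Π̂`
  have hspl' : ∀ x, {T | X.IsSplittingSubgroup x T} =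
      {T : Subgroup X.PiTemp | IsClosed (T : Set X.PiTemp) ∧ T ⊓ Subgroup.center X.PiTemp = ⊥ ∧
        T ⊔ Subgroup.center X.PiTemp = ⊤} := fun x => X.setOf_isSplittingSubgroup_of_disc (hD x) (hI x)
  have hhat : ∀ x, X.hatOf {T | X.IsSplittingSubgroup x T} =
      {T : Subgroup X.PiHat | IsClosed (T : Set X.PiHat) ∧ T ⊓ Subgroup.center X.PiHat = ⊥ ∧
        T ⊔ Subgroup.center X.PiHat = ⊤} := fun x => X.hatOf_splittings_of_disc e he (hD x) (hI x)
  -- the leaves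
  have h66 : Ω.toTemperedOrigin.ProfiniteOuterIsoLiftsHolds := by
    rintro Y Y' (rfl : Y = X) (rfl : Y' = Y)
    exact TemperedCurve.profiniteOuterIsoLifts_of_compactSpace _ _
  have h65 : Ω.toTemperedOrigin.CuspidalAbsolutenessHolds := by
    rintro Y Y' (rfl : Y = X) (rfl : Y' = Y)
    exact TemperedCurve.isoPreservesCuspidalDecomp_of_disc _ _ (fun x _ => ⟨hD x, hI x⟩) (hcusp x₀)
      (hD x₀) (hI x₀)
  have hgsL : ∀ Y : TemperedCurve p, Ω.IsHyperbolicCurveOrigin Y →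
      ∃ (E : FundamentalExtension.{0}) (j : Y.PiHat →ₜ* E.arith) (C : E.CuspidalData)
        (κ : ∀ x : Y.Pt, Y.IsCusp x → C.Cusp),
        Function.Injective j ∧
          (∀ (x x' : Y.Pt) (hx : Y.IsCusp x) (hx' : Y.IsCusp x'), κ x hx = κ x' hx' → x = x') ∧
          (∀ (x : Y.Pt) (hx : Y.IsCusp x),
            C.Dcusp (κ x hx) = ((Y.decomp x).map Y.toHat.toMonoidHom).map j.toMonoidHom) ∧
          GalSect.Thm_1_3_ii_cusps C := by
    rintro Y (rfl : Y = X)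
    exact Y.exists_galSect_dictionary_of_disc x₀ haug hbij hD hI
  have hDcL : ∀ Y : TemperedCurve p, Ω.IsHyperbolicCurveOrigin Y → ∀ y : Y.Pt,
      IsCompact (Y.decomp y : Set Y.PiTemp) := by
    rintro Y (rfl : Y = X) y
    rw [hD y, Subgroup.coe_top]
    exact isCompact_univ
  have hgood : ∀ (X : TemperedCurve p) (kX : KummerUnitData X), Ω.IsHyperbolicCurveOrigin X →
      Ω.IsKummerOrigin kX → ∀ (Y : TemperedCurve p) (kY : KummerUnitData Y) (t : KummerTransport kX kY),
      Ω.IsHyperbolicCurveOrigin Y → Ω.IsKummerOrigin kY → Ω.IsKummerTransportOrigin t →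
      ∀ (αhat : X.PiHat ≃ₜ* Y.PiHat) (β : X.PiTemp ≃ₜ* Y.PiTemp), TemperedCurve.LiesUnder X Y αhat β →
        (kX.unitImage).map (t.h1OfHat αhat).toAddMonoidHom =
          (kX.unitImage).map (t.h1OfTemp β).toAddMonoidHom := by
    intro Y kY _ hkY Y' kY' t _ hkY' _ αhat β _
    rw [hrigidK kY kY' hkY hkY' (t.h1OfHat αhat), hrigidK kY kY' hkY hkY' (t.h1OfTemp β)]
  have hsubL : ∀ (Y : TemperedCurve p) (SY : CuspidalStructures Y), Ω.IsHyperbolicCurveOrigin Y →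
      Ω.IsStructuresOrigin SY → ∀ y : Y.Pt, Y.IsCusp y → ∀ T ∈ SY.canonicalDiscrete y,
        IsClosed (T : Set Y.PiTemp) ∧ T ≤ Y.decomp y := by
    rintro Y SY (rfl : Y = X) hSY y _ T hT
    rw [(hSY y).1] at hT
    exact ⟨hT.1, hT.2.1⟩
  have hstabSpl : ∀ (y : X.Pt) (t : X.PiTemp), ∀ T ∈ {T | X.IsSplittingSubgroup y T},
      ConjAct.toConjAct t • T ∈ {T | X.IsSplittingSubgroup y T} := by
    intro y t T hT
    rw [hspl'] at hT ⊢
    rw [← image_conjAct_smul_centerSplittings_eq (ConjAct.toConjAct t)]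
    exact Set.mem_image_of_mem _ hT
  have hstabL : ∀ (Y : TemperedCurve p) (SY : CuspidalStructures Y), Ω.IsHyperbolicCurveOrigin Y →
      Ω.IsStructuresOrigin SY → ∀ y : Y.Pt, Y.IsCusp y → ∀ t ∈ Y.decomp y,
        (∀ T ∈ SY.canonicalDiscrete y, ConjAct.toConjAct t • T ∈ SY.canonicalDiscrete y) ∧
          ∀ T ∈ SY.canonicalIntegral y, ConjAct.toConjAct t • T ∈ SY.canonicalIntegral y := by
    rintro Y SY (rfl : Y = X) hSY y _ t -
    refine ⟨fun T hT => ?_, fun T hT => ?_⟩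
    · rw [(hSY y).1] at hT ⊢
      exact hstabSpl y t T hT
    · rw [(hSY y).2] at hT ⊢
      exact hstabSpl y t T hT
  have hCor411 : ∀ (X : TemperedCurve p) (SX : CuspidalStructures X) (kX : KummerUnitData X)
      (aX : TemperedCurve.CurveArithmeticFlags X), Ω.IsHyperbolicCurveOrigin X →
      Ω.IsStructuresOrigin SX → Ω.IsKummerOrigin kX → Ω.IsFlagsOrigin aX →
      SX.HasStableReduction → aX.IsIsogenousToGenusZero →
        Ω.IsUnitwiseAbsolute kX ∧
          ∀ x : X.Pt, X.IsCusp x → X.IsRationalPt x → Ω.IsIntegrallyAbsoluteCusp SX x := by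
    rintro Y SY kY aY (rfl : Y = X) hSY hkY _ _ _
    refine ⟨fun Y' kY' t _ hkY' _ αhat => hrigidK kY kY' hkY hkY' (t.h1OfHat αhat), ?_⟩
    rintro x - - Y' SY' (rfl : Y' = Y) hSY' αhat y γhat - -
    rw [(hSY x).2, (hSY' y).2, hhat x, hhat y, image_map_centerSplittings_eq αhat,
      image_conjAct_smul_centerSplittings_eq γhat]
  refine ⟨Ω, X, S, k, a, rfl, fun x => ⟨rfl, rfl⟩, ⟨AddEquiv.refl ℤ, ?_⟩, trivial,
    ⟨x₀, hcusp x₀, hrat x₀⟩, trivial, fun x => hspl x, hU, fun _ _ _ => trivial,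
    h66, h65, hgsL, hDcL, hgood, hsubL, hstabL, hCor411⟩
  change U.map (AddEquiv.refl ℤ).toAddMonoidHom = U
  exact addSubgroup_map_int_addEquiv_gs _ U

/-- **END-TO-END: the `…_of_galSect` closers FIRE at the certificate.**  Feeding the witness of
`exists_cusped_certificate_galSect_leaves` term for term into `temperedAbsolutenessHolds_of_galSect` and
`genusZeroTempAbsolutenessHolds_of_galSect` gives an `Ω` — certifying a §6 datum with a `K`-rational cusp, so
not a vacuous origin — at which F-1656 `TemperedAbsolutenessHolds Ω` and F-1655
`GenusZeroTempAbsolutenessHolds Ω` hold.  Toy certificate; this shows the closers' antecedent is THEIRS and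
satisfiable, nothing about hyperbolic curves. [cite: MochizukiSemiAnbd2006, Cor 6.11 pp.77-78] -/
theorem exists_cusped_certificate_temperedAbsoluteness_of_galSect (p : ℕ) [Fact p.Prime] :
    ∃ Ω : AbsolutenessOrigin p,
      Ω.TemperedAbsolutenessHolds ∧ Ω.GenusZeroTempAbsolutenessHolds ∧
        ∃ X : TemperedCurve p, Ω.IsHyperbolicCurveOrigin X ∧ ∃ x : X.Pt, X.IsCusp x ∧ X.IsRationalPt x := by
  obtain ⟨Ω, X, -, -, -, hX, -, -, -, hx, -, -, -, -, h66, h65, hgs, hDc, hgood, hsub, hstab, hCor411⟩ :=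
    exists_cusped_certificate_galSect_leaves p
  exact ⟨Ω, Ω.temperedAbsolutenessHolds_of_galSect h66 h65 hgs hDc hgood hsub hstab,
    Ω.genusZeroTempAbsolutenessHolds_of_galSect h66 h65 hgs hDc hgood hsub hstab hCor411, X, hX, hx⟩

end AbsolutenessOrigin

end Literature.AnabelianGeometry.SemiGraphs

end
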